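import Summits.MatrixMultiplication.MatrixMultiplication.Theorems.ObstructionDescentUniversalOccurrenceTwoRectangleSmallTypes
import Summits.MatrixMultiplication.MatrixMultiplication.Theorems.ObstructionDescentUniversalOccurrenceTwoRectangleTwoRows
import Summits.MatrixMultiplication.MatrixMultiplication.Theorems.ObstructionDescentUniversalOccurrenceTwoRectangleThreeRowsTwo
import Summits.MatrixMultiplication.MatrixMultiplication.Theorems.ObstructionDescentUniversalOccurrenceTwoRectangleFourRowsTwoTwo

set_option linter.dupNamespace false
set_option autoImplicit false

/-!
# Universal occurrence — two rectangles: EVERY EVEN TYPE WITH `ν₃ ≤ 2` OCCURS (decomp-mm · lens 3 · gen 43, part X)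

Route `route-MatrixMultiplication-ObstructionDescent` (sub-problem `MatrixMultiplication`, `ω(ℂ) = 2`); SUPPORT for the crux
`NoOccurrenceObstruction` (`P_O`, item `stmt-MatrixMultiplication-29040`) through the universal-occurrence programme (NODE-g29…g43
of the decomp-mm cell, lens 3).  Nothing here proves `ω = 2` or closes an item; no `def`, no `sorry`, standard axioms.

**Main theorem** (`occurs_unitTensor_twoRectangle_evenTypes`).  Let `m ≥ N` and `ν ⊢ 2N` with sorted parts `a :: rest`, where
every part in `rest` is even, every part of `rest` after the first equals `2`, and `rest` has at most three entries — i.e. `ν` is an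
EVEN partition (the first part is then even automatically) with at most four rows and `ν₃ ≤ 2`.  Then `((2^N),(2^N),ν)` OCCURS in
`ℂ[GL×GL×GL · ⟨m⟩^{⊗ 2N}]`.  This packages the one-row type (part K) and the three two-parameter families proved uniformly in `k`:
`(2N-2k,2k)` (part O), `(2N-2k-4,2k+2,2)` (part S), `(2N-2k-6,2k+2,2,2)` (part W); the floor `N ≥ …` of each family is exactly
the sortedness `ν₁ ≥ ν₂`.  (Recall `g((N,N),(N,N),ν) > 0` iff `ν` has at most four parts, all even or all odd
[Brown–van Willigenburg–Zabrocki]; the `δ = 2` floor law reaches even types only, since the content of `g ∘ w_σ` is twice the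
content of `g`.)

[cite: BurgisserIkenmeyer2011, §3.4 (Prop. 3.4), Thm. 4.4] [cite: BurgisserIkenmeyer2017, §5, Thm. 5.9 (proof of (2)), eq. (3.4)]
[cite: BurgisserChristandlIkenmeyer2011, Thm. 1 with proof]
-/

noncomputable section

namespace Summit.MatrixMultiplication.MatrixMultiplication.Theorems.ObstructionCalculus

open Literature.Computability.AlgebraicComplexity

/-- **Every even type `((2^N),(2^N),ν)` with at most four rows and `ν₃ ≤ 2` occurs for `⟨m⟩`, `m ≥ N`.**
[cite: BurgisserIkenmeyer2011, Thm. 4.4] [cite: BurgisserIkenmeyer2017, Thm. 5.9 (proof of (2))] -/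
theorem occurs_unitTensor_twoRectangle_evenTypes {N m : ℕ} (hNm : N ≤ m)
    {lam : Fin 3 → Nat.Partition (N * 2)} (h0 : lam 0 = Nat.Partition.rectangle N 2)
    (h1 : lam 1 = Nat.Partition.rectangle N 2) {a : ℕ} {rest : List ℕ}
    (h2 : (lam 2).sortedParts = a :: rest) (heven : ∀ x ∈ rest, Even x) (htail : ∀ x ∈ rest.tail, x = 2)
    (hlen : rest.length ≤ 3) :
    isotypicSum₁ (lam 0) (isotypicSum₂ (lam 1) (isotypicSum₃ (lam 2)
      (kroneckerPow (unitTensor ℂ m) (N * 2)))) ≠ 0 := by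
  have hsum : a + rest.sum = N * 2 := by
    have := (lam 2).sum_sortedParts; rwa [h2, List.sum_cons] at this
  have hsort : ∀ x ∈ rest, x ≤ a := by
    have := (lam 2).sortedGE_sortedParts
    rw [h2, List.sortedGE_iff_pairwise, List.pairwise_cons] at this
    exact this.1
  have hpos : ∀ x ∈ rest, 0 < x := fun x hx =>
    (lam 2).pos_of_mem_sortedParts (by rw [h2]; exact List.mem_cons_of_mem _ hx)
  rcases rest with _ | ⟨b, _ | ⟨c, _ | ⟨d, _ | ⟨x, u⟩⟩⟩⟩
  · -- one row: `ν = (2N)`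
    exact occurs_unitTensor_twoRectangle_smallTypes hNm h0 h1 (by simp) h2
  · -- two rows: `ν = (2N-2k, 2k)`
    obtain ⟨r, hr⟩ := heven b (by simp)
    have hb := hpos b (by simp)
    have hba := hsort b (by simp)
    simp only [List.sum_cons, List.sum_nil] at hsum
    exact occurs_unitTensor_twoRectangle_twoRows (k := r) (by omega) (by omega) hNm h0 h1
      (by rw [h2]; congr 1 <;> [omega; (congr 1; omega)])
  · -- three rows: `ν = (2N-2k-4, 2k+2, 2)`
    obtain ⟨r, hr⟩ := heven b (by simp)
    have hc : c = 2 := htail c (by simp)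
    have hba := hsort b (by simp)
    have hcb : c ≤ b := by
      have := (lam 2).sortedGE_sortedParts
      rw [h2, List.sortedGE_iff_pairwise, List.pairwise_cons, List.pairwise_cons] at this
      exact this.2.1 c (by simp)
    simp only [List.sum_cons, List.sum_nil] at hsum
    exact occurs_unitTensor_twoRectangle_threeRowsTwo (k := r - 1) (by omega) hNm h0 h1
      (by rw [h2, hc]; congr 1 <;> [omega; (congr 1; omega)])
  · -- four rows: `ν = (2N-2k-6, 2k+2, 2, 2)`
    obtain ⟨r, hr⟩ := heven b (by simp)
    have hc : c = 2 := htail c (by simp)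
    have hd : d = 2 := htail d (by simp)
    have hba := hsort b (by simp)
    have hcb : c ≤ b := by
      have := (lam 2).sortedGE_sortedParts
      rw [h2, List.sortedGE_iff_pairwise, List.pairwise_cons, List.pairwise_cons] at this
      exact this.2.1 c (by simp)
    simp only [List.sum_cons, List.sum_nil] at hsum
    exact occurs_unitTensor_twoRectangle_fourRowsTwoTwo (k := r - 1) (by omega) hNm h0 h1
      (by rw [h2, hc, hd]; congr 1 <;> [omega; (congr 1; omega)])
  · -- five or more rows are excluded
    simp only [List.length_cons] at hlen
    omega

end Summit.MatrixMultiplication.MatrixMultiplication.Theorems.ObstructionCalculus
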